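import Literature.NumberTheory.Kottwitz1986.RegularAndSigns
import Literature.NumberTheory.Automorphic.LocalOrbitalIntegral
import Mathlib.Algebra.BigOperators.Finprod
import Mathlib.Data.Complex.Basic
import HarnessLib

/-!
# Kottwitz 1986, §5 «Local conjectures (orbital integrals)»: `O_γ`, `SO_γ = Σ e(I′) O_{γ′}`, CONJECTURE 5.3 (stability of
# `SO_γ`), the expected transfer `f ↦ f^H` with `SO_{γ_H}(f^H) = Σ Δ(γ_H, γ) O_γ(f)` (5.4), CONJECTURE 5.5 (extension of `Δ` to
# `(G, H)`-regular `γ_H` with the signs `e(G_γ)`), and 5.6 (`e(T) = 1`, `Δ(γ_H, γ′) = Δ(γ_H, γ)⟨inv(γ, γ′), κ⟩`, `O^κ_γ`) — the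
# orbital integrals WITH BODIES over the tree's `orbitalIntegral`, the printed statements as a LETTER (nothing asserted)

R. E. Kottwitz, *Stable trace formula: elliptic singular terms*, Math. Ann. **275** (1986) 365–399 [Kottwitz1986], §5
pp. 379–381.  Source text: the open GDZ digitisation (Göttingen, PPN235181684_0275 LOG_0056, store key `paper:url-ecbc59a1db27`;
canvas = printed page + 6): publisher OCR per page in the cell at `run/shared/lean/pub/hodgecm-mathlib/lit/lit3/g0/texts/Kottwitz1986-GDZ/
p0379.txt … p0381.txt`, every formula READ on the page images `…/T/KOT/TK-t11/g0/img/p0379.jpg … p0381.jpg`.  Squad TK (HCML «GO 500»),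
typer TK-t11; target `Literature/NumberTheory/Kottwitz1986/LocalConjectures.lean`, namespace
`Literature.NumberTheory.Kottwitz1986.LocalConjectures`.  STATEMENTS ONLY (cell TYPER LINT RULE): one `structure LocalConjecturesData`
over the §4 datum ★ `RegularAndSigns.LocalSignsDatum` (itself over the §1 datum ★ `LocalCohomology.LocalDatum`), definitions WITH
BODIES for the functionals the print defines (`SO`, `inv`, `Okappa`) in the tree's orbital-integral currency
★ `Literature.NumberTheory.Automorphic.orbitalIntegral` (measure a parameter), and `Prop`-valued relations (one `def` per printed
statement, verbatim numbering); the two CONJECTURES and the «one expects» of 5.4 are typed as named `Prop`s like theorems (they are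
hypotheses either way; the docstrings say «Conjecture» ∕ «expected»; squad ruling V4).  No theorem, no proof, no `sorry`, no `axiom`,
no `instance`, no `notation`.  ED. 2 (same day): the four summed relations carry the finiteness of the representative sets as an
in-statement hypothesis (squad pre-flight rule D5), and the Morel cross-reference below.

## Source, verbatim (formulas from the page images)

(p. 379) «In this section `F` is a local field of characteristic 0 and `G` is a connected reductive group over `F`. To keep the
discussion as simple as possible we assume that `G_der` is simply connected, so that `G_γ` is connected for all semi-simple `γ ∈ G`,
and stable conjugacy and `G(F̄)`-conjugacy are the same [K1]. The general case is no harder, but leads to more awkward statements.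
**5.1.** We need to recall that there is a sign `e(I) = ±1` attached to any connected reductive group `I` over `F` [K2].  **5.2.** Let
`γ` be a semi-simple element of `G(F)` and let `I = G_γ = G_γ⁰`. Choose Haar measures `dg`, `di` on `G(F)`, `I(F)` respectively, and
let `O_γ` denote the linear form on» (p. 380) «`C_c^∞(G(F))` given by `O_γ(f) = ∫_{I(F)\G(F)} f(g⁻¹γg) dg/di`. For any stable
conjugate `γ′ ∈ G(F)` of `γ` the group `I′ = G_{γ′}` is an inner twist of `I` and in the usual way `di` gives us a Haar measure `di′`
on `I′(F)`. We use `dg`, `di′` to form `O_{γ′}`, and we define a linear form `SO_γ` on `C_c^∞(G(F))` by the formula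
`SO_γ = Σ_{γ′} e(I′) O_{γ′}`, where `γ′` runs over a set of representatives for the conjugacy classes in the stable conjugacy class of
`γ`. For `G` such that `G_der` is not simply connected it is necessary to modify the definition of `SO_γ` by including the factor
`|ker[H¹(F, I′) → H¹(F, G_{γ′})]|` in the summand indexed by `γ′` [as usual, `I′ = (G_{γ′})⁰`].  **5.3. Conjecture.** The distribution
`SO_γ` is stable (see [L2] for the definition of stable distribution).  **5.4.** Let `(H, s, η)` be an endoscopic triple for `G`.
Choose an extension of `η : Ĥ → Ĝ` to an `L`-homomorphism `η′ : ᴸH → ᴸG`. One expects to have a correspondence `(f, f^H)` [L2, S2]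
between functions `f ∈ C_c^∞(G(F))`, `f^H ∈ C_c^∞(H(F))`, such that `SO_{γ_H}(f^H) = Σ_γ Δ(γ_H, γ) O_γ(f)` for every `G`-regular
semi-simple element `γ_H ∈ H(F)`. The sum runs over a set of representatives for the conjugacy classes in `G(F)` belonging to the
`G(F̄)`-conjugacy class associated to `γ_H` (3.1); if this `G(F̄)`-conjugacy class contains no element of `G(F)`, than the sum is empty
and the right side of the equation is 0. The complex numbers `Δ(γ_H, γ)` are called transfer factors; at the moment these have a
complete definition only in the archimedean case [S2]. Presumably the final definition, whatever it turns out to be, will only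
specify the function `Δ(·, ·)` up to multiplication by a non-zero scalar. Of course changing `Δ(·, ·)` by a scalar causes the
correspondence `(f, f^H)` to change by that scalar. The correspondence and the transfer factors depend on `η′`.  **5.5. Conjecture.**
The function `Δ(·, ·)` can be extended (continuously, in all likelihood) to all pairs `(γ_H, γ)` consisting of a `(G, H)`-regular
semi-simple element `γ_H ∈ H(F)` and a corresponding element `γ ∈ G(F)`, in such a way that `SO_{γ_H}(f^H) = Σ_γ Δ(γ_H, γ) e(G_γ) O_γ(f)`.
We are again using compatible measures on `I_{γ_H}`, `G_γ` as in 5.2 [the two groups are inner twists of each other since `γ_H` is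
`(G, H)`-regular].  **5.6.** Note that `e(T) = 1` for any torus `T`, so that 5.5 is compatible with 5.4 in case `γ_H` is `G`-regular.
The relation between `Δ(γ_H, γ)`, `Δ(γ_H, γ′)` for `γ′ ∈ G(F)` in the stable conjugacy class of `γ` should be
`Δ(γ_H, γ′) = Δ(γ_H, γ)⟨inv(γ, γ′), κ⟩`.» (p. 381) «Here `inv(γ, γ′)` is the element of `𝔈(I/F)` obtained as the image under
`𝔇(I/F) → 𝔈(I/F)` of the element of `𝔇(I/F)` that measures the difference between `γ, γ′` (see 4.1). The element `κ ∈ 𝔎(I/F)` comes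
from `s` via `Z(Ĥ) ↪ Z(Î_H) ⥲ Z(Î)`, and `⟨·, ·⟩` denotes the duality pairing between `𝔈(I/F)` and `𝔎(I/F)` (see 4.6). Thus we could
also write the equation in 5.5 as `SO_{γ_H}(f^H) = Δ(γ_H, γ) O^κ_γ(f)`, where `O^κ_γ(f) = Σ_{γ′} ⟨inv(γ, γ′), κ⟩ e(G_{γ′}) O_{γ′}(f)`.»

## What is typed, and how

* `LocalConjecturesData L D G` — ONE posited datum for a fixed group `G : L.Grp` of the §1 datum `L` and the §4 datum `D` (so that
  `H¹(F, ·)`, `α`, `I = D.cent γ`, stable conjugacy `D.IsStConj`, the torsor classes `D.invD`, `𝔈(I/F) = D.frakE`, `𝔎(I/F) = D.frakK`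
  and the pairing `D.pair` are the IMPORTED ones), with `G(F) = D.GF G` carrying a group structure, a topology and σ-algebras on the
  orbit spaces `G(F) ⧸ C(γ)` as INSTANCE PARAMETERS (no instance is declared).  Standing hypothesis behind it: `G_der` simply connected
  (p. 379), so `I = G_γ` and `I(F) = C_{G(F)}(γ)`, the centralizer the tree's `orbitalIntegral` quotients by.  Fields: the test space
  `C_c^∞(G(F))`; the signs `e(G_γ)` [K2] (values in `ℤˣ`); «`G_γ` is a torus»; the orbital measures `dg/di′` on `G(F) ⧸ C(γ′)` for the
  stable conjugates `γ′` of `γ` (5.2); the chosen sets of representatives of the conjugacy classes inside a stable class; «stable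
  distribution» [L2] as a predicate on linear forms; the endoscopic triples `(H, s, η)` with `H(F)`, `C_c^∞(H(F))`, the extensions
  `η′`, the correspondence `f ↦ f^H`, `SO_{γ_H}` on `H` (5.2 for `H`), «semi-simple», «`G`-regular», «`(G, H)`-regular» (§3; root-datum
  meaning ★ `RegularAndSigns.IsGRegular ∕ IsGHRegular`), «`γ` belongs to the `G(F̄)`-class associated to `γ_H` (3.1)» with chosen
  representatives, the transfer factors `Δ(γ_H, γ)` (depending on `η′`), the compatible measures of 5.4–5.5, and the element `κ` of 5.6.
* DEFINED over it (bodies): **`SO`** `= Σ_{γ′} e(I′) O_{γ′}` (a `finsum`; `O_{γ′}` = ★ `orbitalIntegral γ′ f (dg/di′)`), **`inv`**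
  `= α_I(invD)` (p. 381), **`Okappa`** `= O^κ_γ`.
* RELATIONS: `TestSpec`, `ConjAgrees` (the §4 posited `G(F)`-conjugacy is conjugacy in the group `G(F)`), `StRepsSpec`, `CorrSpec`,
  `CorrRepsSpec`, `KappaMem` (book-keeping of the posited choices), **`Kottwitz1986_5_3`** (CONJECTURE 5.3), **`Kottwitz1986_5_4`** («one
  expects»), **`Kottwitz1986_5_5`** (CONJECTURE 5.5), **`Kottwitz1986_5_6_torus`** (`e(T) = 1`), **`Kottwitz1986_5_6_delta`** («should be»),
  **`Kottwitz1986_5_6_kappaForm`**, and the conjunction `PrintedLaws5`.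
NOT typed: the modification of `SO_γ` for `G_der` not simply connected (recorded above in words), continuity of the extended `Δ`
(«in all likelihood»), [K1], [K2] = Kottwitz, *Sign changes in harmonic analysis on reductive groups* (1983) (the sign `e(G)`: carpet
★ `Literature.NumberTheory.Kottwitz1983.SignChanges`, `LocalSignDatum.e`, cited not restated), [L2], [S2].  The tree's
`adelicStableOrbitalIntegralG`, `localStableOrbitalIntegral`, `LocalTransferFactor`, `finExplicitTransferFactor…` under
`Literature/NumberTheory/Automorphic/` and `…/Rogawski1990/` are the `U(3)`-specialised readings of this section (DEDUP 2026-09-02: cite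
tags «Kottwitz1986, §5 ∕ 5.x» = 0 in the tree; no general stable orbital integral or transfer factor before this file).

CROSS-REFERENCE (squad QA T-ref5 «QA-5», 2026-09-02; ED. 2): S. Morel, *On the cohomology of certain non-compact Shimura varieties*
(2010), §5.3 RECALLS 5.2 ∕ 5.4 ∕ 5.5 of this paper (her [K7]) — typed as the generic-group letter ★
`Literature.NumberTheory.Automorphic.Morel2010Shimura.Ch5GeometricSideStableTF`: `signedStableOrbitalIntegral` (Kottwitz's `SO_γ = Σ e(G_{γ′}) O_{γ′}`
over ★ `classOrbitalIntegral`, stable conjugacy ∕ signs ∕ measures as parameters on a bare group) and `LocalTransferData.IsTransfer` ∕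
`TransferExists` (the identity `SO_{γ_H}(f^H) = Σ_γ Δ(γ_H, γ) e(G_γ) O_γ(f)` of 5.4 ∕ 5.5).  Different letters — that one parametrises a bare pair of
groups, this one the §1 ∕ §4 datum tower of [Kottwitz1986] (so that `inv`, `κ`, `⟨·, ·⟩`, `𝔈`, `𝔎` of 5.6 are the §4 objects) — and neither is a
drop-in for the other; a consolidation may later derive one from the other.  A THIRD letter of the same printed object `SO_γ = Σ e(G_{γ′}) O_{γ′}`
([K7] 5.2 as recalled in Kottwitz, *Base change for unit elements of Hecke algebras*, Compositio 60 (1986), p. 239) is ★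
`Literature.NumberTheory.Kottwitz1986BaseChangeUnits.UnitOrbitalIntegrals.UnitOrbitalData` (fields `SO`, relation `SOLaw`; squad TK, t12;
abstract-group sockets for the base-change unit fundamental lemma) — dictionary: `LocalConjecturesData.SO` (this file, datum tower) ↔
`signedStableOrbitalIntegral` (Morel, generic group) ↔ `UnitOrbitalData.SO`∕`SOLaw` (BCU sockets) (T-ref5 «QA-10» NB-1).

## References
* [Kottwitz1986] R. E. Kottwitz, Stable trace formula: elliptic singular terms, Math. Ann. 275 (1986) 365–399, §5: 5.1–5.2 (pp. 379–380),
  Conjecture 5.3, 5.4, Conjecture 5.5, 5.6 (p. 380), 5.6 continued (p. 381); §3.1 (p. 378), §4.1, 4.4, 4.6 (pp. 378–379).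
* J. D. Rogawski, *Automorphic Representations of Unitary Groups in Three Variables* (1990), §4.9 p. 54 (the tree's `orbitalIntegral`).
  [Rogawski1990]
-/

noncomputable section

open MeasureTheory

namespace Literature.NumberTheory.Kottwitz1986.LocalConjectures

open Literature.NumberTheory.Automorphic (orbitalIntegral)

universe u

/-! ## §0 Two notions at the level of the §4 datum: `inv(γ, γ′)` and «conjugacy in `G(F)`» -/

section SignsLevel

variable {L : LocalCohomology.LocalDatum.{u}} (D : RegularAndSigns.LocalSignsDatum L)

/-- **`inv(γ, γ′) ∈ 𝔈(I/F)`**: «the image under `𝔇(I/F) → 𝔈(I/F)` of the element of `𝔇(I/F)` that measures the difference between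
`γ, γ′` (see 4.1)» — `α_I` (Theorem 1.2, `L.alpha`) of the torsor class `D.invD γ γ′` (the map of 4.4). [cite: Kottwitz1986, §5.6 (p. 381)] -/
def inv {G : L.Grp} (γ γ' : D.GF G) (h : D.IsStConj γ γ') : L.A (D.cent γ) :=
  L.alpha (D.cent γ) (D.invD γ γ' h)

/-- The §4 datum's posited `G(F)`-conjugacy is conjugacy in the group `G(F)` (for a group structure on `G(F) = D.GF G`).
[cite: Kottwitz1986, §4.1 (p. 378), §5.2 (p. 380)] -/
def ConjAgrees (G : L.Grp) [Group (D.GF G)] : Prop :=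
  ∀ γ γ' : D.GF G, D.IsConjF γ γ' ↔ IsConj γ γ'

end SignsLevel

/-! ## §1 The posited datum of §5 -/

/-- **The data of Kottwitz's §5 AS A DATUM**, for a fixed connected reductive `F`-group `G : L.Grp` (`F` local of characteristic 0,
`G_der` simply connected, p. 379) of the §1 datum `L` and the §4 datum `D`; PARAMETERS: the group structure and topology of
`G(F) = D.GF G` and a σ-algebra on each `G(F) ⧸ C(γ)`.  Fields: `C_c^∞(G(F))`; `e(G_γ)` (5.1, [K2]); «`G_γ` is a torus» (5.6); the
measures `dg/di′` of 5.2; the chosen representatives of the conjugacy classes in a stable class (5.2); «stable distribution» [L2]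
(5.3); the endoscopic data of 5.4–5.6 (`(H, s, η)`, `H(F)`, `C_c^∞(H(F))`, `η′`, `f ↦ f^H`, `SO_{γ_H}`, semi-simple ∕ `G`-regular ∕
`(G, H)`-regular elements of `H(F)`, «corresponds (3.1)» with chosen representatives, `Δ(γ_H, γ)`, the compatible measures, `κ`).
No field asserts a printed statement. [cite: Kottwitz1986, §5 (pp. 379–381)] -/
structure LocalConjecturesData (L : LocalCohomology.LocalDatum.{u}) (D : RegularAndSigns.LocalSignsDatum L) (G : L.Grp)
    [Group (D.GF G)] [TopologicalSpace (D.GF G)]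
    [∀ γ : D.GF G, MeasurableSpace (D.GF G ⧸ Subgroup.centralizer ({γ} : Set (D.GF G)))] : Type (u + 1) where
  /-- the test functions `C_c^∞(G(F))` [§5.2 pp. 379–380] -/
  Test : Set (D.GF G → ℂ)
  /-- `e(G_γ) = e(I) = ±1`, the sign [K2] of the connected reductive group `I = G_γ` [§5.1 p. 379; §5.2 p. 380 «`e(I′)`»] -/
  eCent : D.GF G → ℤˣ
  /-- «`G_γ` is a torus `T`» (`γ` regular semi-simple) [§5.6 p. 380 «`e(T) = 1` for any torus `T`»] -/
  CentIsTorus : D.GF G → Prop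
  /-- for `γ` and a stable conjugate `γ′`: the measure on `G(F) ⧸ C(γ′) = I′(F)\G(F)` formed from `dg` and `di′`, «in the usual way `di`
  gives us a Haar measure `di′` on `I′(F)`» (for `γ′ = γ`: `dg/di`) [§5.2 p. 380] -/
  mOrb : (γ γ' : D.GF G) → Measure (D.GF G ⧸ Subgroup.centralizer ({γ'} : Set (D.GF G)))
  /-- «a set of representatives for the conjugacy classes in the stable conjugacy class of `γ`» [§5.2 p. 380] -/
  StReps : D.GF G → Set (D.GF G)
  /-- «stable distribution» in the sense of [L2], as a predicate on linear forms on `C_c^∞(G(F))` [§5.3 p. 380] -/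
  IsStable : ((D.GF G → ℂ) → ℂ) → Prop
  /-- the endoscopic triples `(H, s, η)` for `G` [§5.4 p. 380] -/
  Endo : Type u
  /-- `H(F)` [§5.4 p. 380] -/
  HF : Endo → Type u
  /-- the test functions `C_c^∞(H(F))` [§5.4 p. 380] -/
  TestH : (e : Endo) → Set (HF e → ℂ)
  /-- the extensions `η′ : ᴸH → ᴸG` of `η : Ĥ → Ĝ` to an `L`-homomorphism [§5.4 p. 380] -/
  LHom : Endo → Type u
  /-- the correspondence `f ↦ f^H` (depending on `η′`) [§5.4 p. 380] -/
  transfer : (e : Endo) → LHom e → (D.GF G → ℂ) → (HF e → ℂ)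
  /-- `SO_{γ_H}`, the stable orbital integral on `H(F)` (5.2 for `H`) [§5.4 p. 380] -/
  SOH : (e : Endo) → HF e → (HF e → ℂ) → ℂ
  /-- «semi-simple element `γ_H ∈ H(F)`» [§5.4 p. 380] -/
  IsSSH : (e : Endo) → HF e → Prop
  /-- «`G`-regular» (root-datum meaning: ★ `RegularAndSigns.IsGRegular`) [§5.4 p. 380] -/
  IsGRegularH : (e : Endo) → HF e → Prop
  /-- «`(G, H)`-regular» (§3.1; root-datum meaning: ★ `RegularAndSigns.IsGHRegular`) [§5.5 p. 380] -/
  IsGHRegularH : (e : Endo) → HF e → Prop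
  /-- «`γ ∈ G(F)` belongs to the `G(F̄)`-conjugacy class associated to `γ_H` (3.1)» ∕ «a corresponding element `γ ∈ G(F)`» [§5.4, 5.5 p. 380] -/
  Corr : (e : Endo) → HF e → D.GF G → Prop
  /-- «a set of representatives for the conjugacy classes in `G(F)` belonging to the `G(F̄)`-conjugacy class associated to `γ_H`»
  (possibly empty) [§5.4 p. 380] -/
  CorrReps : (e : Endo) → HF e → Set (D.GF G)
  /-- the transfer factors `Δ(γ_H, γ) ∈ ℂ` (for `η′`; defined for `G`-regular `γ_H` [S2], extended to `(G, H)`-regular `γ_H` in 5.5) [§5.4–5.5 p. 380] -/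
  Delta : (e : Endo) → LHom e → HF e → D.GF G → ℂ
  /-- the measure on `G(F) ⧸ C(γ)` used in 5.4–5.5 for `γ` corresponding to `γ_H`: «compatible measures on `I_{γ_H}`, `G_γ` as in 5.2»
  [§5.5 p. 380] -/
  mOrbH : (e : Endo) → HF e → (γ : D.GF G) → Measure (D.GF G ⧸ Subgroup.centralizer ({γ} : Set (D.GF G)))
  /-- «The element `κ ∈ 𝔎(I/F)` comes from `s` via `Z(Ĥ) ↪ Z(Î_H) ⥲ Z(Î)`» (`I = G_γ`, `γ` corresponding to `γ_H`), as an element of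
  `π₀([Z(Î)/Z(Ĝ)]^Γ) = D.PiZ γ` [§5.6 p. 381] -/
  kappaOf : (e : Endo) → (γH : HF e) → (γ : D.GF G) → Corr e γH γ → D.PiZ γ

namespace LocalConjecturesData

variable {L : LocalCohomology.LocalDatum.{u}} {D : RegularAndSigns.LocalSignsDatum L} {G : L.Grp}
  [Group (D.GF G)] [TopologicalSpace (D.GF G)]
  [∀ γ : D.GF G, MeasurableSpace (D.GF G ⧸ Subgroup.centralizer ({γ} : Set (D.GF G)))]
  (X : LocalConjecturesData L D G)

/-! ## §2 The functionals the print defines (bodies) -/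

/-- **`SO_γ(f) = Σ_{γ′} e(I′) O_{γ′}(f)`** (5.2), `γ′` over the chosen representatives of the conjugacy classes in the stable class of
`γ`, `O_{γ′}(f) = ∫_{I′(F)\G(F)} f(g⁻¹γ′g) dg/di′` = the tree's `orbitalIntegral γ′ f (dg/di′)` (a `finsum`; finiteness of the set
of representatives is part of `StRepsSpec`). [cite: Kottwitz1986, §5.2 (p. 380)] -/
def SO (γ : D.GF G) (f : D.GF G → ℂ) : ℂ :=
  ∑ᶠ γ' ∈ X.StReps γ, ((X.eCent γ' : ℤ) : ℂ) * orbitalIntegral γ' f (X.mOrb γ γ')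

/-- **`O^κ_γ(f) = Σ_{γ′} ⟨inv(γ, γ′), κ⟩ e(G_{γ′}) O_{γ′}(f)`** (5.6), `γ′` over the chosen representatives of the conjugacy classes in
the stable class of `γ` (the inner `finsum` over the proofs `h : γ′` stably conjugate to `γ` supplies `inv(γ, γ′)`; by `StRepsSpec`
every representative is a stable conjugate), `⟨·, ·⟩ = D.pair γ`, measures `dg/di′` as in 5.2. [cite: Kottwitz1986, §5.6 (p. 381)] -/
def Okappa (γ : D.GF G) (κ : D.PiZ γ) (f : D.GF G → ℂ) : ℂ :=
  ∑ᶠ (γ' : D.GF G) (h : D.IsStConj γ γ') (_ : γ' ∈ X.StReps γ),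
    D.pair γ (inv D γ γ' h) κ * ((X.eCent γ' : ℤ) : ℂ) * orbitalIntegral γ' f (X.mOrb γ γ')

/-! ## §3 Book-keeping relations on the posited choices -/

/-- `C_c^∞(G(F))` consists of compactly supported functions (the smoothness ∕ local constancy is left to the posited set).
[cite: Kottwitz1986, §5.2 (pp. 379–380)] -/
def TestSpec : Prop :=
  ∀ f ∈ X.Test, HasCompactSupport f

/-- `StReps γ` IS «a set of representatives for the conjugacy classes in the stable conjugacy class of `γ`» (for semi-simple `γ`):
finite, made of stable conjugates of `γ`, pairwise non-conjugate, meeting every conjugacy class in the stable class.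
[cite: Kottwitz1986, §5.2 (p. 380)] -/
def StRepsSpec : Prop :=
  ∀ γ : D.GF G, D.IsSS γ →
    (X.StReps γ).Finite ∧ (∀ γ' ∈ X.StReps γ, D.IsStConj γ γ') ∧
      (∀ γ' ∈ X.StReps γ, ∀ γ'' ∈ X.StReps γ, IsConj γ' γ'' → γ' = γ'') ∧
        ∀ γ' : D.GF G, D.IsStConj γ γ' → ∃ γ'' ∈ X.StReps γ, IsConj γ' γ''

/-- «the `G(F̄)`-conjugacy class associated to `γ_H` (3.1)» meets `G(F)` in a union of whole stable (= `G(F̄)`-) conjugacy classes —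
under `G_der` simply connected, in at most one: two corresponding elements are stably conjugate, and a stable conjugate of a
corresponding element corresponds. [cite: Kottwitz1986, §5.4 (p. 380), §3.1 (p. 378)] -/
def CorrSpec : Prop :=
  ∀ (e : X.Endo) (γH : X.HF e) (γ γ' : D.GF G), X.Corr e γH γ → (X.Corr e γH γ' ↔ D.IsStConj γ γ')

/-- `CorrReps e γ_H` IS «a set of representatives for the conjugacy classes in `G(F)` belonging to the `G(F̄)`-conjugacy class
associated to `γ_H`»: finite, made of corresponding elements, pairwise non-conjugate, meeting every such conjugacy class («if this
`G(F̄)`-conjugacy class contains no element of `G(F)`, than the sum is empty» — then `CorrReps e γ_H = ∅`).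
[cite: Kottwitz1986, §5.4 (p. 380)] -/
def CorrRepsSpec : Prop :=
  ∀ (e : X.Endo) (γH : X.HF e), X.IsSSH e γH →
    (X.CorrReps e γH).Finite ∧ (∀ γ ∈ X.CorrReps e γH, X.Corr e γH γ) ∧
      (∀ γ ∈ X.CorrReps e γH, ∀ γ' ∈ X.CorrReps e γH, IsConj γ γ' → γ = γ') ∧
        ∀ γ : D.GF G, X.Corr e γH γ → ∃ γ' ∈ X.CorrReps e γH, IsConj γ γ'

/-- «The element `κ ∈ 𝔎(I/F)`»: the posited `κ` lies in `𝔎(I/F) = D.frakK γ`. [cite: Kottwitz1986, §5.6 (p. 381)] -/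
def KappaMem : Prop :=
  ∀ (e : X.Endo) (γH : X.HF e) (γ : D.GF G) (hc : X.Corr e γH γ), X.kappaOf e γH γ hc ∈ D.frakK γ

/-! ## §4 The printed statements of §5 as relations over the datum

CONSUMER NOTE (squad QA T-ref5 «QA-11» NB-3, ED. 2): the relations `Kottwitz1986_5_3 ∕ _5_4 ∕ _5_5 ∕ _5_6_kappaForm` are meant to be
assumed TOGETHER with the book-keeping relations `StRepsSpec` ∕ `CorrSpec` ∕ `CorrRepsSpec` ∕ `KappaMem` (or simply `PrintedLaws5`): the
sums are `finsum`s over the posited representative sets, and only those relations say that the sets ARE finite systems of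
representatives; since ED. 2 each summed relation also carries the finiteness of its index set as an explicit hypothesis. -/

/-- **5.3** (p. 380; printed as 5.3, NOT as a theorem — it is one of «the local [hypotheses] in Sect. 5» that 9.3 assumes, ★
`Stabilization.StabilizationData.LocalGlobalHypotheses`): «The distribution `SO_γ` is stable (see [L2] for the definition of stable
distribution).» — for every semi-simple `γ ∈ G(F)`, the chosen set of representatives being finite (the print's «a set of
representatives for the conjugacy classes in the stable conjugacy class», finitely many; guard against the `finsum` junk value, ED. 2).
Typed as a named `Prop` over the datum; nothing asserts it; its later status is not recorded here. [cite: Kottwitz1986, §5.3 (p. 380)] -/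
def Kottwitz1986_5_3 : Prop :=
  ∀ γ : D.GF G, D.IsSS γ → (X.StReps γ).Finite → X.IsStable (X.SO γ)

/-- **5.4** (p. 380, «One EXPECTS to have a correspondence `(f, f^H)` [L2, S2] … such that»): for `f ∈ C_c^∞(G(F))`, `f^H ∈ C_c^∞(H(F))`
and `SO_{γ_H}(f^H) = Σ_γ Δ(γ_H, γ) O_γ(f)` for every `G`-regular semi-simple `γ_H ∈ H(F)`, the sum over the representatives of the
conjugacy classes in `G(F)` inside the `G(F̄)`-class associated to `γ_H` (a finite set — in-statement guard against the `finsum` junk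
value, ED. 2; empty sum = 0 as printed).  An expectation in print, typed as a named hypothesis on the posited `transfer` and `Delta`.
[cite: Kottwitz1986, §5.4 (p. 380)] -/
def Kottwitz1986_5_4 : Prop :=
  ∀ (e : X.Endo) (η' : X.LHom e), ∀ f ∈ X.Test,
    X.transfer e η' f ∈ X.TestH e ∧
      ∀ γH : X.HF e, X.IsSSH e γH → X.IsGRegularH e γH → (X.CorrReps e γH).Finite →
        X.SOH e γH (X.transfer e η' f) =
          ∑ᶠ γ ∈ X.CorrReps e γH, X.Delta e η' γH γ * orbitalIntegral γ f (X.mOrbH e γH γ)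

/-- **5.5** (p. 380; printed as 5.5, NOT as a theorem — assumed in 6.9 and in 9.3): «The function `Δ(·, ·)` can be extended
(continuously, in all likelihood) to all pairs `(γ_H, γ)` consisting of a `(G, H)`-regular semi-simple element `γ_H ∈ H(F)` and a
corresponding element `γ ∈ G(F)`, in such a way that `SO_{γ_H}(f^H) = Σ_γ Δ(γ_H, γ) e(G_γ) O_γ(f)`» (compatible measures on `I_{γ_H}`,
`G_γ`).  Typed for the posited (total) `Delta`: the identity holds for every `(G, H)`-regular semi-simple `γ_H` whose (finite) set of
representatives is given; nothing asserts it; its later status is not recorded here. [cite: Kottwitz1986, §5.5 (p. 380)] -/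
def Kottwitz1986_5_5 : Prop :=
  ∀ (e : X.Endo) (η' : X.LHom e), ∀ f ∈ X.Test,
    ∀ γH : X.HF e, X.IsSSH e γH → X.IsGHRegularH e γH → (X.CorrReps e γH).Finite →
      X.SOH e γH (X.transfer e η' f) =
        ∑ᶠ γ ∈ X.CorrReps e γH, X.Delta e η' γH γ * ((X.eCent γ : ℤ) : ℂ) * orbitalIntegral γ f (X.mOrbH e γH γ)

/-- **5.6** (p. 380): «Note that `e(T) = 1` for any torus `T`» — `e(G_γ) = 1` whenever `G_γ` is a torus («so that 5.5 is compatible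
with 5.4 in case `γ_H` is `G`-regular»). [cite: Kottwitz1986, §5.6 (p. 380)] -/
def Kottwitz1986_5_6_torus : Prop :=
  ∀ γ : D.GF G, X.CentIsTorus γ → X.eCent γ = 1

/-- **5.6** (pp. 380–381): «The relation between `Δ(γ_H, γ)`, `Δ(γ_H, γ′)` for `γ′ ∈ G(F)` in the stable conjugacy class of `γ` SHOULD BE
`Δ(γ_H, γ′) = Δ(γ_H, γ)⟨inv(γ, γ′), κ⟩`» — for `(G, H)`-regular semi-simple `γ_H` and `γ` corresponding, `κ` from `s`, `⟨·, ·⟩` the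
pairing of 4.6.  Printed «should be» (a requirement on the extended `Δ` of 5.5, not a theorem); nothing asserts it.
[cite: Kottwitz1986, §5.6 (pp. 380–381)] -/
def Kottwitz1986_5_6_delta : Prop :=
  ∀ (e : X.Endo) (η' : X.LHom e) (γH : X.HF e) (γ : D.GF G) (hc : X.Corr e γH γ) (γ' : D.GF G)
    (h : D.IsStConj γ γ'), X.IsSSH e γH → X.IsGHRegularH e γH →
      X.Delta e η' γH γ' = X.Delta e η' γH γ * D.pair γ (inv D γ γ' h) (X.kappaOf e γH γ hc)

/-- **5.6** (p. 381): «Thus we could also write the equation in 5.5 as `SO_{γ_H}(f^H) = Δ(γ_H, γ) O^κ_γ(f)`» — for `(G, H)`-regular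
semi-simple `γ_H`, `γ` corresponding, `κ` from `s`, the representatives of the stable class of `γ` a finite set, when the measures `dg/di′`
of 5.2 at `γ` are the compatible ones of 5.5. [cite: Kottwitz1986, §5.6 (p. 381)] -/
def Kottwitz1986_5_6_kappaForm : Prop :=
  ∀ (e : X.Endo) (η' : X.LHom e), ∀ f ∈ X.Test, ∀ (γH : X.HF e) (γ : D.GF G) (hc : X.Corr e γH γ),
    X.IsSSH e γH → X.IsGHRegularH e γH → (X.StReps γ).Finite →
      (∀ γ' : D.GF G, D.IsStConj γ γ' → X.mOrbH e γH γ' = X.mOrb γ γ') →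
        X.SOH e γH (X.transfer e η' f) = X.Delta e η' γH γ * X.Okappa γ (X.kappaOf e γH γ hc) f

/-- The printed laws of §5 together (book-keeping of the choices, 5.3, the expectation of 5.4, 5.5 and 5.6).
[cite: Kottwitz1986, §5 (pp. 379–381)] -/
def PrintedLaws5 : Prop :=
  X.TestSpec ∧ ConjAgrees D G ∧ X.StRepsSpec ∧ X.CorrSpec ∧ X.CorrRepsSpec ∧ X.KappaMem ∧ X.Kottwitz1986_5_3 ∧
    X.Kottwitz1986_5_4 ∧ X.Kottwitz1986_5_5 ∧ X.Kottwitz1986_5_6_torus ∧ X.Kottwitz1986_5_6_delta ∧ X.Kottwitz1986_5_6_kappaForm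

end LocalConjecturesData

end Literature.NumberTheory.Kottwitz1986.LocalConjectures

end
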